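import Mathlib
import Summits.NavierStokesRegularity.NavierStokesRegularity.Theorems.LerayQuarterDissipationFiniteDissipationLiouvilleWindowGradientCore
import HarnessLib

/-!
# Crux `FiniteDissipationLiouville` (stmt-NavierStokesRegularity-22144): ONE-WINDOW REGULARITY CRITERIA FOR
# THE PRODUCTION READ-OUTS — a balanced (or sub-caloric) window of `|log ε|` e-folds excludes the singularity

Theorems file of route `LerayQuarterDissipation` (lead prover g19; `--supports` the crux; sequel of
`…WindowRecurrence`, `…WindowRecurrenceStretching`, `…WindowRecurrenceProduction`, `…WindowGradientCore`).
Navier–Stokes regularity is NOT proved by anything here; no summit is.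

`…WindowCollar` stated the contrapositives of the window theorems for the SPEED as regularity criteria
(`not_singular_of_slow_window` …). The same reading for the production read-outs:

* **`not_singular_of_balanced_window`** (enveloped frame, law-free) — there is `ε(A) ∈ (0,1)` such that a
  KNSS-gauge Type-I field (`C ≤ A`) with a Type-I envelope `HasTypeIDecay A V` whose Lamb-form local balance
  `⟪u, ω × curl ω⟫ ≤ ‖curl ω‖² + ‖ω‖²/(4(−t))` holds throughout ONE window `[−c², −εc²] × ℝ³` is NOT singular
  at the apex (lead g18 needed the whole final slab `[τ, 0)`); `not_singular_of_stretching_balanced_window` —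
  the same for the stretching form `⟪ω, ∇u ω⟫ ≤ |∇ω|²_F + ‖ω‖²/(4(−t))`;
* **`not_singular_of_subcaloric_window`** (CRUX FRAME: Type-I + law, no envelope) — there is
  `ε(C,K) ∈ (0,1)` such that a member of `𝒟_{C,K}` whose scale-invariant enstrophy density `t²‖ω‖²` is a
  SUB-SOLUTION of `∂ₜ + u·∇ − Δ` (i.e. `(−t)(⟪ω, ∇u ω⟫ − |∇ω|²_F) ≤ ‖ω‖²`) at every point of ONE window
  `[−c², −εc²] × ℝ³` is NOT singular; `not_singular_of_credit_window` — the same with any credit `a < 1`;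
* the MEASURE forms: `not_singular_of_small_superCaloric_volume` (super-caloric volume `< η(C,K)c⁵` in one
  window ⇒ not singular), `not_singular_of_few_superCaloric_times` (enveloped members of the stratum:
  super-caloric instants of measure `< κ c²` in one window ⇒ not singular), `not_singular_of_small_excess_volume`
  (Lamb excess volume `< η(A)c⁵` in one window ⇒ not singular).

HONEST FRAMING. Contrapositives (ε-regularity-type criteria with INEFFECTIVE thresholds) of this
generation's compactness corollaries; law-free on the enveloped class resp. in the crux's frame on the
stratum. Nothing is removed from the DSS wall (`∀ c>1 TypeIDSSLiouville c`, NECESSARY for the crux).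
Nothing here bears on NS regularity.

References: Koch–Nadirashvili–Seregin–Šverák, Acta Math. 203 (2009) §4; folklore.
-/

noncomputable section

set_option linter.dupNamespace false

namespace Summit.NavierStokesRegularity.NavierStokesRegularity.Theorems.FiniteDissipationLiouville.WindowRecurrence

open MeasureTheory Set Filter Topology Metric InnerProductSpace Function Real
open scoped RealInnerProductSpace ContDiff ENNReal
open Literature.Analysis Literature.Analysis.FluidPDE
open Summit.NavierStokesRegularity.NavierStokesRegularity.Theorems
open Summit.NavierStokesRegularity.NavierStokesRegularity.Theorems.FiniteDissipationLiouville

/-! ### Pointwise criteria on one window -/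

section Pointwise

/-- **A LAMB-BALANCED WINDOW EXCLUDES THE SINGULARITY (enveloped frame).**
[folklore + KNSS compactness; cite: KochNadirashviliSereginSverak2009, §4 (arXiv:0709.3599 p. 8)] -/
theorem not_singular_of_balanced_window (A : ℝ) : ∃ ε : ℝ, 0 < ε ∧ ε < 1 ∧
    ∀ (C : ℝ) (V : ℝ → EuclideanSpace ℝ (Fin 3) → EuclideanSpace ℝ (Fin 3)),
      IsTypeIAncientMild C V → C ≤ A → HasTypeIDecay A V →
      ∀ c : ℝ, 0 < c →
      (∀ t ∈ Icc (-c ^ 2) (-(ε * c ^ 2)), ∀ x : EuclideanSpace ℝ (Fin 3),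
        ⟪V t x, cross (curl (V t) x) (curl (curl (V t)) x)⟫ ≤
          ‖curl (curl (V t)) x‖ ^ 2 + ‖curl (V t) x‖ ^ 2 / (4 * (-t))) →
      ¬ (∀ r > 0, ∀ M : ℝ, ∃ t ∈ Ioo (-(r ^ 2)) (0 : ℝ),
        ∃ x ∈ ball (0 : EuclideanSpace ℝ (Fin 3)) r, M < ‖V t x‖) := by
  obtain ⟨ε, hε, hε1, h⟩ := localBalance_excess_in_every_window A
  refine ⟨ε, hε, hε1, fun C V hV hCA hdec c hc hbal hsing => ?_⟩
  obtain ⟨t, ht, x, hx⟩ := h C V hV hCA hdec hsing c hc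
  exact (not_le.2 hx) (hbal t ht x)

/-- **A STRETCHING-BALANCED WINDOW EXCLUDES THE SINGULARITY (enveloped frame).**
[folklore + KNSS compactness; cite: KochNadirashviliSereginSverak2009, §4 (arXiv:0709.3599 p. 8)] -/
theorem not_singular_of_stretching_balanced_window (A : ℝ) : ∃ ε : ℝ, 0 < ε ∧ ε < 1 ∧
    ∀ (C : ℝ) (V : ℝ → EuclideanSpace ℝ (Fin 3) → EuclideanSpace ℝ (Fin 3)),
      IsTypeIAncientMild C V → C ≤ A → HasTypeIDecay A V →
      ∀ c : ℝ, 0 < c →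
      (∀ t ∈ Icc (-c ^ 2) (-(ε * c ^ 2)), ∀ x : EuclideanSpace ℝ (Fin 3),
        ⟪curl (V t) x, fderiv ℝ (V t) x (curl (V t) x)⟫ ≤
          frobeniusNormSq (fderiv ℝ (curl (V t)) x) + ‖curl (V t) x‖ ^ 2 / (4 * (-t))) →
      ¬ (∀ r > 0, ∀ M : ℝ, ∃ t ∈ Ioo (-(r ^ 2)) (0 : ℝ),
        ∃ x ∈ ball (0 : EuclideanSpace ℝ (Fin 3)) r, M < ‖V t x‖) := by
  obtain ⟨ε, hε, hε1, h⟩ := stretching_excess_in_every_window A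
  refine ⟨ε, hε, hε1, fun C V hV hCA hdec c hc hbal hsing => ?_⟩
  obtain ⟨t, ht, x, hx⟩ := h C V hV hCA hdec hsing c hc
  exact (not_le.2 hx) (hbal t ht x)

/-- **A SUB-CALORIC WINDOW EXCLUDES THE SINGULARITY (crux frame).** There is `ε(C,K) ∈ (0,1)`: a member of
`𝒟_{C,K}` whose `t²‖ω‖²` satisfies `(−t)(⟪ω, ∇u ω⟫ − |∇ω|²_F) ≤ ‖ω‖²` throughout ONE window
`[−c², −εc²] × ℝ³` is NOT singular at the apex. [parabolic strong maximum principle + KNSS compactness;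
cite: KochNadirashviliSereginSverak2009, §4 (arXiv:0709.3599 p. 8)] -/
theorem not_singular_of_subcaloric_window (C K : ℝ) : ∃ ε : ℝ, 0 < ε ∧ ε < 1 ∧
    ∀ (V : ℝ → EuclideanSpace ℝ (Fin 3) → EuclideanSpace ℝ (Fin 3)), IsTypeIAncientMild C V →
      (∀ s : ℝ, s < 0 → ∫⁻ x, ‖fderiv ℝ (V s) x‖ₑ ^ 2 ≤ ENNReal.ofReal (K / Real.sqrt (-s))) →
      ∀ c : ℝ, 0 < c →
      (∀ s ∈ Icc (-c ^ 2) (-(ε * c ^ 2)), ∀ y : EuclideanSpace ℝ (Fin 3),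
        (-s) * (⟪curl (V s) y, fderiv ℝ (V s) y (curl (V s) y)⟫ - frobeniusNormSq (fderiv ℝ (curl (V s)) y)) ≤
          ⟪curl (V s) y, curl (V s) y⟫) →
      ¬ (∀ r > 0, ∀ M : ℝ, ∃ t ∈ Ioo (-(r ^ 2)) (0 : ℝ),
        ∃ x ∈ ball (0 : EuclideanSpace ℝ (Fin 3)) r, M < ‖V t x‖) := by
  obtain ⟨ε, hε, hε1, h⟩ := superCaloric_in_every_window C K
  refine ⟨ε, hε, hε1, fun V hV hlaw c hc hsub hsing => ?_⟩
  obtain ⟨s, hs, y, hy⟩ := h V hV hlaw hsing c hc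
  exact (not_le.2 hy) (hsub s hs y)

/-- **A WINDOW WITH CREDIT `a < 1` EXCLUDES THE SINGULARITY (crux frame).** [parabolic strong maximum principle
+ KNSS compactness; cite: KochNadirashviliSereginSverak2009, §4 (arXiv:0709.3599 p. 8)] -/
theorem not_singular_of_credit_window {a : ℝ} (ha : a < 1) (C K : ℝ) : ∃ ε : ℝ, 0 < ε ∧ ε < 1 ∧
    ∀ (V : ℝ → EuclideanSpace ℝ (Fin 3) → EuclideanSpace ℝ (Fin 3)), IsTypeIAncientMild C V →
      (∀ s : ℝ, s < 0 → ∫⁻ x, ‖fderiv ℝ (V s) x‖ₑ ^ 2 ≤ ENNReal.ofReal (K / Real.sqrt (-s))) →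
      ∀ c : ℝ, 0 < c →
      (∀ s ∈ Icc (-c ^ 2) (-(ε * c ^ 2)), ∀ y : EuclideanSpace ℝ (Fin 3),
        (-s) * (⟪curl (V s) y, fderiv ℝ (V s) y (curl (V s) y)⟫
          - a * frobeniusNormSq (fderiv ℝ (curl (V s)) y)) ≤ ⟪curl (V s) y, curl (V s) y⟫) →
      ¬ (∀ r > 0, ∀ M : ℝ, ∃ t ∈ Ioo (-(r ^ 2)) (0 : ℝ),
        ∃ x ∈ ball (0 : EuclideanSpace ℝ (Fin 3)) r, M < ‖V t x‖) := by
  obtain ⟨ε, hε, hε1, h⟩ := critProd_excess_in_every_window ha C K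
  refine ⟨ε, hε, hε1, fun V hV hlaw c hc hsub hsing => ?_⟩
  obtain ⟨s, hs, y, hy⟩ := h V hV hlaw hsing c hc
  exact (not_le.2 hy) (hsub s hs y)

end Pointwise

/-! ### Measure criteria on one window -/

section Measure

/-- **SMALL SUPER-CALORIC VOLUME IN ONE WINDOW EXCLUDES THE SINGULARITY (crux frame).** There are
`ε(C,K) ∈ (0,1)`, `η(C,K) > 0`: a member of `𝒟_{C,K}` whose super-caloric set meets ONE window
`[−c², −εc²] × ℝ³` in volume `< η c⁵` is NOT singular. [cite: KochNadirashviliSereginSverak2009, §4 (arXiv:0709.3599 p. 8)] -/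
theorem not_singular_of_small_superCaloric_volume (C K : ℝ) : ∃ ε : ℝ, 0 < ε ∧ ε < 1 ∧ ∃ η : ℝ, 0 < η ∧
    ∀ (V : ℝ → EuclideanSpace ℝ (Fin 3) → EuclideanSpace ℝ (Fin 3)), IsTypeIAncientMild C V →
      (∀ s : ℝ, s < 0 → ∫⁻ x, ‖fderiv ℝ (V s) x‖ₑ ^ 2 ≤ ENNReal.ofReal (K / Real.sqrt (-s))) →
      ∀ c : ℝ, 0 < c →
      volume {p : ℝ × EuclideanSpace ℝ (Fin 3) | p.1 ∈ Icc (-c ^ 2) (-(ε * c ^ 2)) ∧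
        ⟪curl (V p.1) p.2, curl (V p.1) p.2⟫ < (-p.1) * (⟪curl (V p.1) p.2,
          fderiv ℝ (V p.1) p.2 (curl (V p.1) p.2)⟫ - frobeniusNormSq (fderiv ℝ (curl (V p.1)) p.2))} <
        ENNReal.ofReal (η * c ^ 5) →
      ¬ (∀ r > 0, ∀ M : ℝ, ∃ t ∈ Ioo (-(r ^ 2)) (0 : ℝ),
        ∃ x ∈ ball (0 : EuclideanSpace ℝ (Fin 3)) r, M < ‖V t x‖) := by
  obtain ⟨ε, hε, hε1, η, hη, h⟩ := superCaloric_volume_scaled C K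
  refine ⟨ε, hε, hε1, η, hη, fun V hV hlaw c hc hvol hsing => ?_⟩
  exact (not_le.2 hvol) (h V hV hlaw hsing c hc)

/-- **FEW SUPER-CALORIC INSTANTS IN ONE WINDOW EXCLUDE THE SINGULARITY** (members of the stratum with a
Type-I envelope, e.g. the critical element). [cite: KochNadirashviliSereginSverak2009, §4 (arXiv:0709.3599 p. 8)] -/
theorem not_singular_of_few_superCaloric_times (A K : ℝ) : ∃ ε : ℝ, 0 < ε ∧ ε < 1 ∧ ∃ κ : ℝ, 0 < κ ∧
    ∀ (C : ℝ) (V : ℝ → EuclideanSpace ℝ (Fin 3) → EuclideanSpace ℝ (Fin 3)),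
      IsTypeIAncientMild C V → C ≤ A → HasTypeIDecay A V →
      (∀ s : ℝ, s < 0 → ∫⁻ x, ‖fderiv ℝ (V s) x‖ₑ ^ 2 ≤ ENNReal.ofReal (K / Real.sqrt (-s))) →
      ∀ c : ℝ, 0 < c →
      volume {t : ℝ | t ∈ Icc (-c ^ 2) (-(ε * c ^ 2)) ∧
        ∃ y : EuclideanSpace ℝ (Fin 3),
          ⟪curl (V t) y, curl (V t) y⟫ < (-t) * (⟪curl (V t) y, fderiv ℝ (V t) y (curl (V t) y)⟫
            - frobeniusNormSq (fderiv ℝ (curl (V t)) y))} < ENNReal.ofReal (κ * c ^ 2) →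
      ¬ (∀ r > 0, ∀ M : ℝ, ∃ t ∈ Ioo (-(r ^ 2)) (0 : ℝ),
        ∃ x ∈ ball (0 : EuclideanSpace ℝ (Fin 3)) r, M < ‖V t x‖) := by
  obtain ⟨ε, hε, hε1, κ, hκ, h⟩ := superCaloricTimes_measure_ge A K
  refine ⟨ε, hε, hε1, κ, hκ, fun C V hV hCA hdec hlaw c hc hvol hsing => ?_⟩
  exact (not_le.2 hvol) (h C V hV hCA hdec hlaw hsing c hc)

/-- **SMALL LAMB-EXCESS VOLUME IN ONE WINDOW EXCLUDES THE SINGULARITY (enveloped frame).**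
[cite: KochNadirashviliSereginSverak2009, §4 (arXiv:0709.3599 p. 8)] -/
theorem not_singular_of_small_excess_volume (A : ℝ) : ∃ ε : ℝ, 0 < ε ∧ ε < 1 ∧ ∃ η : ℝ, 0 < η ∧
    ∀ (C : ℝ) (V : ℝ → EuclideanSpace ℝ (Fin 3) → EuclideanSpace ℝ (Fin 3)),
      IsTypeIAncientMild C V → C ≤ A → HasTypeIDecay A V →
      ∀ c : ℝ, 0 < c →
      volume {p : ℝ × EuclideanSpace ℝ (Fin 3) | p.1 ∈ Icc (-c ^ 2) (-(ε * c ^ 2)) ∧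
        ‖curl (curl (V p.1)) p.2‖ ^ 2 + ‖curl (V p.1) p.2‖ ^ 2 / (4 * (-p.1)) <
          ⟪V p.1 p.2, cross (curl (V p.1) p.2) (curl (curl (V p.1)) p.2)⟫} < ENNReal.ofReal (η * c ^ 5) →
      ¬ (∀ r > 0, ∀ M : ℝ, ∃ t ∈ Ioo (-(r ^ 2)) (0 : ℝ),
        ∃ x ∈ ball (0 : EuclideanSpace ℝ (Fin 3)) r, M < ‖V t x‖) := by
  obtain ⟨ε, hε, hε1, η, hη, h⟩ := localBalance_excess_volume_scaled A
  refine ⟨ε, hε, hε1, η, hη, fun C V hV hCA hdec c hc hvol hsing => ?_⟩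
  exact (not_le.2 hvol) (h C V hV hCA hdec hsing c hc)

end Measure

end Summit.NavierStokesRegularity.NavierStokesRegularity.Theorems.FiniteDissipationLiouville.WindowRecurrence

end
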